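import Mathlib
import Literature.Analysis.FluidPDE.ClassicalSolution
import Literature.Analysis.FluidPDE.LerayHopf
import Literature.Analysis.FluidPDE.ConstantinDirectionDissipationProofs
import Literature.Analysis.FluidPDE.TaoEnstrophyLocalisationProofs
import Summits.NavierStokesRegularity.NavierStokesRegularity.Theorems.PlaneEnergyCeilingPlanarEnergyAPrioriPlanarAgmon

/-!
# Route PlaneEnergyCeiling · crux `PlanarEnergyAPriori` — the a-priori floor `P ∈ L²(0,T)`

Helper file for the crux item stmt-NavierStokesRegularity-16855 (`PlanarEnergyAPriori`, route
`PlaneEnergyCeiling`), landed `--supports` that item. The crux asks for a UNIFORM bound on the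
planar kinetic energies `E(u(t);R,c) = ∫_{R({x₂=c})} |u(t)|² dA` along a classical Leray–Hopf
solution. This file records what the energy class gives for free (strategist census
`Cruxes/PlanarEnergyAPriori/STRATEGY-CENSUS.md`, "a-priori floor"): by the planar Agmon
inequality (`Theorems/PlaneEnergyCeilingPlanarEnergyAPrioriPlanarAgmon.lean`),

* `planarEnergy_sq_le_energy_mul_lintegral_frobenius` — for EVERY `t ∈ [0,T)`, every direction
  `R` and offset `c`: `E(u(t);R,c)² ≤ 2E₀ · ∫ |∇u(t)|²_F`, `E₀ = ½‖u(0)‖₂²` (energy inequality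
  of the Leray–Hopf field from `s = 0`, `ν > 0`);
* `lintegral_iSup_planarEnergy_sq_le` — integrating in time with the Leray–Hopf dissipation
  bound `ν∫₀ᵀ∫|∇u|²_F ≤ E₀` (the weak gradient is the classical one,
  `IsLerayHopfOn.lintegral_frobeniusNormSq_fderiv_of_classical`):
  `∫₀ᵀ sup_{R,c} E(u(t);R,c)² dt ≤ 2E₀²/ν = ‖u(0)‖₂⁴/(2ν)`.

So the planar ceiling `P(t) = sup_{R,c} E(u(t);R,c)` is A PRIORI SQUARE-INTEGRABLE on `(0,T)`
with a bound depending only on `‖u(0)‖₂` and `ν`; the crux `PlanarEnergyAPriori` is exactly the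
upgrade `L²_t → L^∞_t` of this critical quantity (the `EnergySupercriticality` gap measured as one
time-integrability exponent). Folklore (Agmon + Leray's energy inequality; Lemarié-Rieusset 2016,
Ch. 11–12).
-/

noncomputable section

-- single-conjunct summit: `Summit.<Summit>.<Problem>` repeats the name by the D-0017 layout
set_option linter.dupNamespace false

namespace Summit.NavierStokesRegularity.NavierStokesRegularity.Theorems.PlanarEnergyAPriori

open MeasureTheory Set Filter Topology WithLp
open scoped ENNReal RealInnerProductSpace
open Literature.Analysis.FluidPDE

variable {ν T : ℝ} {u : ℝ → EuclideanSpace ℝ (Fin 3) → EuclideanSpace ℝ (Fin 3)} {p : ℝ → EuclideanSpace ℝ (Fin 3) → ℝ}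

/-- The operator-norm gradient energy is dominated by the Frobenius one:
`‖Dw(x)‖² ≤ |Dw(x)|²_F` pointwise, hence `∫ ‖Dw‖ₑ² ≤ ∫ |Dw|²_F`. -/
theorem lintegral_enorm_fderiv_sq_le_lintegral_frobenius (w : EuclideanSpace ℝ (Fin 3) → EuclideanSpace ℝ (Fin 3)) :
    ∫⁻ x, ‖fderiv ℝ w x‖ₑ ^ 2 ≤ ∫⁻ x, ENNReal.ofReal (frobeniusNormSq (fderiv ℝ w x)) := by
  refine lintegral_mono fun x => ?_
  rw [← ofReal_norm, ← ENNReal.ofReal_pow (norm_nonneg _)]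
  exact ENNReal.ofReal_le_ofReal (sq_opNorm_le_frobeniusNormSq _)

/-- **Energy of a slice of a Leray–Hopf field (zero force, `ν ≥ 0`).** For every `t ∈ [0,T]`:
`∫ ‖u(t)‖ₑ² ≤ 2E₀`, `E₀ = kineticEnergy (u 0) = ½‖u(0)‖₂²` (the energy inequality from `s = 0`
with the dissipation dropped). -/
theorem lintegral_enorm_sq_le_of_isLerayHopfOn (hlh : IsLerayHopfOn T ν 0 (u 0) u) (hν : 0 ≤ ν) {t : ℝ}
    (ht : t ∈ Icc 0 T) :
    ∫⁻ x, ‖u t x‖ₑ ^ 2 ≤ ENNReal.ofReal (2 * VectorCalculus.kineticEnergy (u 0)) := by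
  obtain ⟨G, -, hE⟩ := hlh.energy_ineq_zero
  have h := hE t ht
  simp only [Pi.zero_apply, inner_zero_left, integral_zero, intervalIntegral.integral_zero,
    add_zero] at h
  have hD : 0 ≤ ν * (∫⁻ τ in Ioo 0 t, ∫⁻ x, ENNReal.ofReal (frobeniusNormSq (G τ x))).toReal :=
    mul_nonneg hν ENNReal.toReal_nonneg
  have hK : VectorCalculus.kineticEnergy (u t) ≤ VectorCalculus.kineticEnergy (u 0) := by linarith
  have heq : ∫⁻ x, ‖u t x‖ₑ ^ 2 = ENNReal.ofReal (2 * VectorCalculus.kineticEnergy (u t)) :=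
    eEnergy_eq_ofReal (u t) (hlh.memLp t ht)
  rw [heq]
  exact ENNReal.ofReal_le_ofReal (by linarith)

/-- **Pointwise-in-time floor.** Along a classical solution on `[0,T)` that is Leray–Hopf from
`u 0` (zero force, `ν ≥ 0`), for EVERY `t ∈ [0,T)`, every linear isometry `R` and offset `c`:
`E(u(t);R,c)² ≤ 2E₀ · ∫ |∇u(t)|²_F` — planar Agmon (`E² ≤ ‖u(t)‖₂² ‖Du(t)‖₂²`) + the energy
inequality + `‖Du‖ ≤ |Du|_F`. The right side may be infinite at exceptional times. [folklore] -/
theorem planarEnergy_sq_le_energy_mul_lintegral_frobenius (hns : IsClassicalNSSolutionOn (Ico 0 T) ν 0 u p)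
    (hlh : IsLerayHopfOn T ν 0 (u 0) u) (hν : 0 ≤ ν) {t : ℝ} (ht : t ∈ Ico 0 T)
    (R : EuclideanSpace ℝ (Fin 3) ≃ₗᵢ[ℝ] EuclideanSpace ℝ (Fin 3)) (c : ℝ) :
    (∫⁻ y : EuclideanSpace ℝ (Fin 2), ‖u t (R (toLp 2 ![y 0, y 1, c]))‖ₑ ^ 2) ^ 2 ≤
      ENNReal.ofReal (2 * VectorCalculus.kineticEnergy (u 0)) *
        ∫⁻ x, ENNReal.ofReal (frobeniusNormSq (fderiv ℝ (u t) x)) := by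
  have hu1 : ContDiff ℝ 1 (u t) := (hns.contDiff_velocity ht).of_le (by exact_mod_cast le_top)
  have hE := lintegral_enorm_sq_le_of_isLerayHopfOn hlh hν (Ico_subset_Icc_self ht)
  have hL2 : ∫⁻ x, ‖u t x‖ₑ ^ 2 < ∞ := hE.trans_lt ENNReal.ofReal_lt_top
  calc (∫⁻ y : EuclideanSpace ℝ (Fin 2), ‖u t (R (toLp 2 ![y 0, y 1, c]))‖ₑ ^ 2) ^ 2
      ≤ (∫⁻ x, ‖u t x‖ₑ ^ 2) * ∫⁻ x, ‖fderiv ℝ (u t) x‖ₑ ^ 2 :=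
        planarEnergy_sq_le_lintegral_mul_lintegral_fderiv' hu1 hL2 R c
    _ ≤ ENNReal.ofReal (2 * VectorCalculus.kineticEnergy (u 0)) *
        ∫⁻ x, ENNReal.ofReal (frobeniusNormSq (fderiv ℝ (u t) x)) :=
        mul_le_mul' hE (lintegral_enorm_fderiv_sq_le_lintegral_frobenius (u t))

/-- **The a-priori floor `P ∈ L²(0,T)`.** Along a classical solution on `[0,T)` (`T > 0`) that
is Leray–Hopf from `u 0` with viscosity `ν > 0` and zero force, the planar ceiling
`P(t)² = sup_{R,c} E(u(t);R,c)²` satisfies `∫₀ᵀ P(t)² dt ≤ 2E₀²/ν`, `E₀ = ½‖u(0)‖₂²` — i.e.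
`∫₀ᵀ P² ≤ ‖u(0)‖₂⁴/(2ν)`. (Pointwise floor, then the Leray–Hopf dissipation bound
`ν∫₀ᵀ∫|∇u|²_F ≤ E₀`, the weak gradient being the classical one.) No measurability of `P` is
needed: the left side is an outer lower Lebesgue integral. [folklore] -/
theorem lintegral_iSup_planarEnergy_sq_le (hns : IsClassicalNSSolutionOn (Ico 0 T) ν 0 u p)
    (hlh : IsLerayHopfOn T ν 0 (u 0) u) (hν : 0 < ν) (hT : 0 < T) :
    ∫⁻ t in Ioo 0 T, ⨆ (R : EuclideanSpace ℝ (Fin 3) ≃ₗᵢ[ℝ] EuclideanSpace ℝ (Fin 3)) (c : ℝ),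
        (∫⁻ y : EuclideanSpace ℝ (Fin 2), ‖u t (R (toLp 2 ![y 0, y 1, c]))‖ₑ ^ 2) ^ 2 ≤
      ENNReal.ofReal (2 * VectorCalculus.kineticEnergy (u 0) ^ 2 / ν) := by
  obtain ⟨hfin, hdiss⟩ := IsLerayHopfOn.lintegral_frobeniusNormSq_fderiv_of_classical hns hlh hT
  set K₀ : ℝ := VectorCalculus.kineticEnergy (u 0) with hK₀
  set D : ℝ≥0∞ := ∫⁻ τ in Ioo 0 T, ∫⁻ x, ENNReal.ofReal (frobeniusNormSq (fderiv ℝ (u τ) x)) with hD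
  have hK₀0 : 0 ≤ K₀ := kineticEnergy_nonneg (u 0)
  have hDle : D ≤ ENNReal.ofReal (K₀ / ν) := by
    rw [← ENNReal.ofReal_toReal hfin]
    refine ENNReal.ofReal_le_ofReal ?_
    rw [le_div_iff₀ hν, mul_comm]
    exact hdiss
  calc ∫⁻ t in Ioo 0 T, ⨆ (R : EuclideanSpace ℝ (Fin 3) ≃ₗᵢ[ℝ] EuclideanSpace ℝ (Fin 3)) (c : ℝ),
          (∫⁻ y : EuclideanSpace ℝ (Fin 2), ‖u t (R (toLp 2 ![y 0, y 1, c]))‖ₑ ^ 2) ^ 2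
      ≤ ∫⁻ t in Ioo 0 T, ENNReal.ofReal (2 * K₀) *
          ∫⁻ x, ENNReal.ofReal (frobeniusNormSq (fderiv ℝ (u t) x)) := by
        refine setLIntegral_mono' measurableSet_Ioo fun t ht => ?_
        refine iSup_le fun R => iSup_le fun c => ?_
        exact planarEnergy_sq_le_energy_mul_lintegral_frobenius hns hlh hν.le ⟨ht.1.le, ht.2⟩ R c
    _ = ENNReal.ofReal (2 * K₀) * D := by
        rw [hD, lintegral_const_mul' _ _ ENNReal.ofReal_ne_top]
    _ ≤ ENNReal.ofReal (2 * K₀) * ENNReal.ofReal (K₀ / ν) := by gcongr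
    _ = ENNReal.ofReal (2 * K₀ ^ 2 / ν) := by
        rw [← ENNReal.ofReal_mul (by positivity)]
        congr 1
        field_simp

/-- **The a-priori floor `P ∈ L²(0,T)`, registered form** (sub-goal `planarCeiling_sq_integrable`
of stmt-NavierStokesRegularity-16855): for `ν > 0`, `T > 0` and every classical solution of
unforced Navier–Stokes on `[0,T)` that is Leray–Hopf from `u 0`,
`∫₀ᵀ sup_{R,c} E(u(t);R,c)² dt ≤ 2E₀²/ν` with `E₀ = ½‖u(0)‖₂²`. [folklore] -/
theorem planarCeiling_sq_integrable : ∀ (ν T : ℝ), 0 < ν → 0 < T → ∀ (u : ℝ → EuclideanSpace ℝ (Fin 3) → EuclideanSpace ℝ (Fin 3)) (p : ℝ → EuclideanSpace ℝ (Fin 3) → ℝ), Literature.Analysis.FluidPDE.IsClassicalNSSolutionOn (Set.Ico 0 T) ν 0 u p → Literature.Analysis.FluidPDE.IsLerayHopfOn T ν 0 (u 0) u → ∫⁻ t in Set.Ioo 0 T, ⨆ (R : EuclideanSpace ℝ (Fin 3) ≃ₗᵢ[ℝ] EuclideanSpace ℝ (Fin 3)) (c : ℝ), (∫⁻ y : EuclideanSpace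 ℝ (Fin 2), ‖u t (R (WithLp.toLp 2 ![y 0, y 1, c]))‖ₑ ^ 2) ^ 2 ≤ ENNReal.ofReal (2 * Literature.Analysis.FluidPDE.VectorCalculus.kineticEnergy (u 0) ^ 2 / ν) :=
  fun _ _ hν hT _ _ hns hlh => lintegral_iSup_planarEnergy_sq_le hns hlh hν hT

end Summit.NavierStokesRegularity.NavierStokesRegularity.Theorems.PlanarEnergyAPriori

end
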